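/-
Copyright (c) 2026. All rights reserved.
Released under Apache 2.0 license as described in the file LICENSE.
Authors: abc-iut cell, wave-5 seat abc-iut-w5-d141 (L3 sub-DAG [SemiAnbd] Thm 5.4, umbrella junction v3c).
-/
import Literature.AnabelianGeometry.SemiGraphs.ArithThm54iiiUmbrella
import Literature.AnabelianGeometry.SemiGraphs.ArithQuasiGeometricCompatOfIota
import HarnessLib

/-!
# [SemiAnbd] Theorem 5.4 (iii), COMPATIBLE reading: the umbrella junction with every non-producer binder
# discharged (junction v3c; proof-only)

Mochizuki, *Semi-graphs of anabelioids*, Publ. RIMS **42** (2006), §5, Theorem 5.4 (iii) p. 66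
[cite: MochizukiSemiAnbd2006, Thm 5.4 (iii), p. 66].

PROOF-ONLY (no definition, nothing asserted).  The umbrella file `ArithThm54iiiUmbrella.lean` (one writer;
v3b `arithQuasiGeometricCorrespondenceStatementCompat_of_iota`, this seat) concludes abc-iut-w4-d083's
`ArithQuasiGeometricCorrespondenceStatementCompat 𝔊 ℍ e augG augH btemp` (the χ2 twin of abc-iut-L3-t3's frozen
statement: clauses 1 and 3 with "arithmetically quasi-geometric" read COMPATIBLY) from the sub-DAG rows, with ONE
binder that is not producer data: `h1c`, the compatibility clause for `B^temp(φ)` itself (the arithmetic R0′).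
abc-iut-w4-d083's `Thm54iii.h1c_of_iota` (`ArithQuasiGeometricCompatOfIota.lean`) derives `h1c` from Thm 5.4
(ii) on both sides, the commensurator descriptions of p. 65, continuity of `augH'`, nontriviality of the
geometric branch groups (`hEgeom`), `hιbtemp` and the `ι`-level compatibility shadow `hιgeomC` (the geometric
R0′ of `B^temp(g)` read through the producer's tempered chart).  This file is the 5-line substitution, kept out
of the umbrella only because of the 400-line cap.  After it, EVERY binder of the compatible Thm 5.4 (iii) is
producer data (rows T54-0/T54-B of HOME/plan/L3/SUBDAG-SemiAnbd-Thm54.md) or a booked row.  Nothing here bears on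
[IUTchIII] Cor. 3.12; typed ≠ proved for the inputs.
-/

namespace Literature.AnabelianGeometry.SemiGraphs

open _root_.CategoryTheory

universe u v w uG uH uV uB uV' uB'

variable {Obj : Type u} [Category.{v} Obj] {𝓥 : SemiAnbdVocab.{u, v, w} Obj}
variable {𝔊 ℍ : ArithSemiGraph 𝓥} {e : 𝔊.PA ≃* ℍ.PA}
variable {Gtp : Type uG} [Group Gtp] [TopologicalSpace Gtp]
variable {Htp : Type uH} [Group Htp] [TopologicalSpace Htp] [IsTopologicalGroup Htp] [T2Space Htp]
variable {V : Type uV} {B : Type uB} {V' : Type uV'} {B' : Type uB'}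
variable {D : DecompositionData Gtp V B} {D' : DecompositionData Htp V' B'}

/-- **[SemiAnbd] Theorem 5.4 (iii), COMPATIBLE reading, every non-producer binder discharged**: as
`arithQuasiGeometricCorrespondenceStatementCompat_of_iota`, with the clause-1 compatibility binder `h1c` (the
arithmetic R0′) REPLACED by abc-iut-w4-d083's `Thm54iii.h1c_of_iota` — from Thm 5.4 (ii) on both sides, the
commensurator descriptions `hcommV` / `hcommV'`, continuity of `augH'`, nontriviality of the geometric branch
groups `hEgeom`, `hιbtemp`, and the `ι`-level compatibility shadow `hιgeomC` (the geometric R0′ of `B^temp(g)`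
through the producer's chart).  After this junction EVERY remaining binder is producer data (T54-0/T54-B) or a
booked row: Thm 5.4 (ii) ×2, Rmk 5.3.1 ×2, `haugH`/`hcont`/`hover`, the Prop 5.2 (iv) dictionary of `ι`
(`hιG hιH hιinj hιbtemp hιgeomV hιgeomE hιgeomC`), the compatible geometric Cor 3.9 (b) at the kernels `hCor39c`,
the Thm 3.7 (iii) shadow `hadj`, `hEgeom`, the p.65 commensurators ×4, `hslim`, `hsurjG`, continuity of `e`, a
vertex of `𝔾`.  Nothing asserted; no side on [IUTchIII] Cor 3.12. [cite: MochizukiSemiAnbd2006, Thm 5.4 (iii), p. 66] -/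
theorem arithQuasiGeometricCorrespondenceStatementCompat_of_iota' (augG : Gtp →* 𝔊.PA) (augH : Htp →* ℍ.PA)
    (btemp : (φ : ArithHom 𝓥 𝔊 ℍ) → φ.IsLocallyOpen → ArithHom.IsOverA 𝔊 ℍ e φ → (Gtp →* Htp))
    (hIIG : ArithMaximalCompactStatementII D augG)
    (hIIH : ArithMaximalCompactStatementII D' (e.symm.toMonoidHom.comp augH))
    (hRG : VerticialEdgeLikeCompactAmpleStatement D augG)
    (hRH : VerticialEdgeLikeCompactAmpleStatement D' (e.symm.toMonoidHom.comp augH))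
    (haugH : Continuous (e.symm.toMonoidHom.comp augH))
    (hcont : ∀ (φ : ArithHom 𝓥 𝔊 ℍ) (h₁ : φ.IsLocallyOpen) (h₂ : ArithHom.IsOverA 𝔊 ℍ e φ),
      Continuous (btemp φ h₁ h₂))
    (hover : ∀ (φ : ArithHom 𝓥 𝔊 ℍ) (h₁ : φ.IsLocallyOpen) (h₂ : ArithHom.IsOverA 𝔊 ℍ e φ),
      (e.symm.toMonoidHom.comp augH).comp (btemp φ h₁ h₂) = augG)
    (hEgeom : ∀ (b : B) (y : Gtp), conjSubgroup y (D.brGp b) ⊓ augG.ker ≠ ⊥)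
    (ι : (𝔊.G ⟶ ℍ.G) → (augG.ker →* Htp))
    (hιG : ∀ (g : 𝔊.G ⟶ ℍ.G) (a : 𝔊.PA) (γ : Gtp), augG γ = a →
      ∃ δ ∈ (e.symm.toMonoidHom.comp augH).ker, ∀ x : augG.ker, ι ((𝔊.ρ a).hom ≫ g) x =
        δ * ι g ⟨γ * x * γ⁻¹, (MonoidHom.normal_ker augG).conj_mem _ x.2 γ⟩ * δ⁻¹)
    (hιH : ∀ (g : 𝔊.G ⟶ ℍ.G) (a : 𝔊.PA) (η : Htp), (e.symm.toMonoidHom.comp augH) η = a →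
      ∃ δ ∈ (e.symm.toMonoidHom.comp augH).ker,
        ∀ x : augG.ker, ι (g ≫ (ℍ.ρ (e a)).hom) x = δ * (η * ι g x * η⁻¹) * δ⁻¹)
    (hιinj : ∀ g₁ g₂ : 𝔊.G ⟶ ℍ.G,
      (∃ δ ∈ (e.symm.toMonoidHom.comp augH).ker, ∀ x : augG.ker, ι g₁ x = δ * ι g₂ x * δ⁻¹) →
        g₁ = g₂)
    (hιbtemp : ∀ (φ : ArithHom 𝓥 𝔊 ℍ) (h₁ : φ.IsLocallyOpen) (h₂ : ArithHom.IsOverA 𝔊 ℍ e φ),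
      ∃ δ ∈ (e.symm.toMonoidHom.comp augH).ker,
        ∀ x : augG.ker, btemp φ h₁ h₂ x = δ * ι φ.geom x * δ⁻¹)
    (hιgeomV : ∀ g : 𝔊.G ⟶ ℍ.G, ∃ fv : V → V', ∀ v : V, ∃ x : Htp,
      ((D.vertGp v ⊓ augG.ker).subgroupOf augG.ker).map (ι g) ≤
          conjSubgroup x (D'.vertGp (fv v)) ⊓ (e.symm.toMonoidHom.comp augH).ker ∧
        IsOpen ((Subtype.val :
            (conjSubgroup x (D'.vertGp (fv v)) ⊓ (e.symm.toMonoidHom.comp augH).ker : Subgroup Htp) → Htp) ⁻¹'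
          (((D.vertGp v ⊓ augG.ker).subgroupOf augG.ker).map (ι g) : Set Htp)))
    (hιgeomE : ∀ g : 𝔊.G ⟶ ℍ.G, ∃ fb : B → B', ∀ b : B, ∃ x : Htp,
      ((D.brGp b ⊓ augG.ker).subgroupOf augG.ker).map (ι g) ≤
          conjSubgroup x (D'.brGp (fb b)) ⊓ (e.symm.toMonoidHom.comp augH).ker ∧
        IsOpen ((Subtype.val :
            (conjSubgroup x (D'.brGp (fb b)) ⊓ (e.symm.toMonoidHom.comp augH).ker : Subgroup Htp) → Htp) ⁻¹'
          (((D.brGp b ⊓ augG.ker).subgroupOf augG.ker).map (ι g) : Set Htp)))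
    (hιgeomC : ∀ (φ : ArithHom 𝓥 𝔊 ℍ), φ.IsLocallyOpen → ∀ (v₁ v₂ : V) (γ₁ γ₂ : Gtp),
      conjSubgroup γ₁ (D.vertGp v₁) ⊓ augG.ker ≠ conjSubgroup γ₂ (D.vertGp v₂) ⊓ augG.ker →
      conjSubgroup γ₁ (D.vertGp v₁) ⊓ conjSubgroup γ₂ (D.vertGp v₂) ⊓ augG.ker ≠ ⊥ →
        ∃ (w₁ w₂ : V') (x₁ x₂ : Htp),
          conjSubgroup x₁ (D'.vertGp w₁) ⊓ (e.symm.toMonoidHom.comp augH).ker ≠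
              conjSubgroup x₂ (D'.vertGp w₂) ⊓ (e.symm.toMonoidHom.comp augH).ker ∧
            MapsOntoOpenSubgroupOf (ι φ.geom) ((conjSubgroup γ₁ (D.vertGp v₁) ⊓ augG.ker).subgroupOf augG.ker)
              (conjSubgroup x₁ (D'.vertGp w₁) ⊓ (e.symm.toMonoidHom.comp augH).ker) ∧
            MapsOntoOpenSubgroupOf (ι φ.geom) ((conjSubgroup γ₂ (D.vertGp v₂) ⊓ augG.ker).subgroupOf augG.ker)
              (conjSubgroup x₂ (D'.vertGp w₂) ⊓ (e.symm.toMonoidHom.comp augH).ker))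
    (hCor39c : ∀ f : Gtp →* Htp, Continuous f → (e.symm.toMonoidHom.comp augH).comp f = augG →
      (∀ v : V, ∃ (w : V') (x : Htp), MapsOntoOpenSubgroupOf f (D.vertGp v ⊓ augG.ker)
        (conjSubgroup x (D'.vertGp w) ⊓ (e.symm.toMonoidHom.comp augH).ker)) →
      (∀ b : B, ∃ (b' : B') (x : Htp), MapsOntoOpenSubgroupOf f (D.brGp b ⊓ augG.ker)
        (conjSubgroup x (D'.brGp b') ⊓ (e.symm.toMonoidHom.comp augH).ker)) →
      (∀ (v₁ v₂ : V) (γ₁ γ₂ : Gtp),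
        conjSubgroup γ₁ (D.vertGp v₁) ⊓ augG.ker ≠ conjSubgroup γ₂ (D.vertGp v₂) ⊓ augG.ker →
        conjSubgroup γ₁ (D.vertGp v₁) ⊓ conjSubgroup γ₂ (D.vertGp v₂) ⊓ augG.ker ≠ ⊥ →
          ∃ (w₁ w₂ : V') (x₁ x₂ : Htp),
            conjSubgroup x₁ (D'.vertGp w₁) ⊓ (e.symm.toMonoidHom.comp augH).ker ≠
                conjSubgroup x₂ (D'.vertGp w₂) ⊓ (e.symm.toMonoidHom.comp augH).ker ∧
              (conjSubgroup γ₁ (D.vertGp v₁) ⊓ augG.ker).map f ≤ conjSubgroup x₁ (D'.vertGp w₁) ∧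
                (conjSubgroup γ₂ (D.vertGp v₂) ⊓ augG.ker).map f ≤ conjSubgroup x₂ (D'.vertGp w₂)) →
      ∃ (g : 𝔊.G ⟶ ℍ.G), ∃ h ∈ (e.symm.toMonoidHom.comp augH).ker,
        ∀ x : augG.ker, f x = h * ι g x * h⁻¹)
    (hadj : ∀ (v₁ v₂ : V) (γ₁ γ₂ : Gtp),
      conjSubgroup γ₁ (D.vertGp v₁) ⊓ augG.ker ≠ conjSubgroup γ₂ (D.vertGp v₂) ⊓ augG.ker →
      conjSubgroup γ₁ (D.vertGp v₁) ⊓ conjSubgroup γ₂ (D.vertGp v₂) ⊓ augG.ker ≠ ⊥ →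
        ∃ E : Subgroup Gtp, IsEdgeLike D E ∧ E ≤ conjSubgroup γ₁ (D.vertGp v₁) ⊓ conjSubgroup γ₂ (D.vertGp v₂))
    (hcommV : ∀ v : V, Subgroup.Commensurable.commensurator (D.vertGp v ⊓ augG.ker) = D.vertGp v)
    (hcommV' : ∀ w : V', Subgroup.Commensurable.commensurator
      (D'.vertGp w ⊓ (e.symm.toMonoidHom.comp augH).ker) = D'.vertGp w)
    (hcommB : ∀ b : B, Subgroup.Commensurable.commensurator (D.brGp b ⊓ augG.ker) = D.brGp b)
    (hcommB' : ∀ b' : B', Subgroup.Commensurable.commensurator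
      (D'.brGp b' ⊓ (e.symm.toMonoidHom.comp augH).ker) = D'.brGp b')
    (hslim : ∀ (w : V') (x : Htp),
      Literature.AlgebraicGeometry.Frobenioids.IsSlimGroup (conjSubgroup x (D'.vertGp w) ⊓ (e.symm.toMonoidHom.comp augH).ker : Subgroup Htp))
    (hsurjG : Function.Surjective augG) (he : Continuous e) (hV : Nonempty V) :
    Literature.AnabelianGeometry.SemiGraphs.ArithQuasiGeometricCorrespondenceStatementCompat 𝔊 ℍ e augG augH
      btemp :=
  arithQuasiGeometricCorrespondenceStatementCompat_of_iota augG augH btemp hIIG hIIH hRG hRH haugH hcont hover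
    (Thm54iii.h1c_of_iota augG (e.symm.toMonoidHom.comp augH) btemp hIIG hIIH haugH hcommV hcommV' hEgeom ι
      hιbtemp hιgeomC)
    ι hιG hιH hιinj hιbtemp hιgeomV hιgeomE hCor39c hadj hcommV hcommV' hcommB hcommB' hslim hsurjG he hV

end Literature.AnabelianGeometry.SemiGraphs
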